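import Mathlib
import HarnessLib
import Summits.Ventures.LatticeQCDFlow.Scaling.AutoregressiveGaugeHeatBathVolumeFloor
import Summits.Ventures.LatticeQCDFlow.Scaling.PlaquettePeelingRank

/-!
# LatticeQCDFlow / Scaling — the heat-bath event floor with the EXACT constant `A(cold) = Z/(c^{#B} M^k)`
# (ranked structure only, no closing map)

HONEST FRAMING: exact (Metropolis-corrected) sampling algorithms for lattice gauge theory;
figures of merit are autocorrelation/cost numbers at stated couplings and volumes; no
continuum-physics claim.

Venture `LatticeQCDFlow` (cell pub-lqcd), topic `Scaling`, FANOUT row 30 (lean-1, GEN-28) — OUR WORK on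
THEORY-2.md §4 row C5.  GEN-26 (`AutoregressiveGaugeHeatBathVolumeFloor`, `…FrozenEvent`) and GEN-27
(`…ClosingMapFloor/Event`) bounded the exact one-plaquette heat-bath sampler from below through a closing
SECTION / MAP: acceptance mass `≤ η·M^k/F_R(U)`, events near the cold configuration with
`τ_int ≥ 1/(ε + 2η) − 1/2`.  The closing map was only ever used to estimate ONE number, `Z/(c^{#B} M^k) ≤ η`.
Stated with that number itself — the EXACT cold escape probability `A(cold)` of
`AutoregressiveGaugeHeatBathColdExact` — the floor needs no closing map and meets the ceiling of
`AutoregressiveGaugeUniformRateExact`: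

* §1 **`heatBath_exactFloor`** — `L ≥ 2`; `w` continuous, `0 < m ≤ w ≤ M`; `(B, t, rank)` ranked (nothing else):
  (a) the acceptance mass from `U` is `≤ Z/(c^{#B} F_R(U)) = A(cold)·M^k/F_R(U)` (the independence-sampler
  bound `A(x) ≤ 1/ω(x)`, exact form); (b) every event `A ⊆ {F_R > θM^k}` of positive probability has
  `τ_int(1_A − π(A)) ≥ 1/(π(A) + A(cold)/θ) − 1/2`, `A(cold) = Z/(c^{#B} M^k)`;
* the companion `AutoregressiveGaugeHeatBathRelaxationScale` makes the event rare (`π(A) < ε`,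
  `τ_int ≥ 1/(ε + 2A(cold)) − 1/2`) and closes the bracket with the sharp ceiling `τ_int ≤ 1/A(cold) − 1/2`:
  the relaxation scale of the exact one-plaquette heat-bath sampler is the inverse cold escape probability
  `c^{#B} M^k/Z`; GEN-26/27's closing sections/maps are estimates of `Z` (`Z ≤ η c^{#B} M^k`), not
  ingredients of the floor.

NOT CLAIMED: the value of `Z/(c^{#B} M^k)` (its volume law is `PlaquettePeelingClosingMap`'s business).
No `def`, no `sorry`, nothing cited as a fact beyond the tree.
-/

noncomputable section

namespace Summit.Ventures.LatticeQCDFlow.Theory2.Autoregressive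

open MeasureTheory ProbabilityTheory Function Finset Filter
open scoped ENNReal Topology
open Literature.MathematicalPhysics.QuantumFieldTheory Literature.MathematicalPhysics.QuantumLattice
open Summit.Ventures.LatticeQCDFlow.Exactness Summit.Ventures.LatticeQCDFlow.Scoring

variable {d L : ℕ} [NeZero L] {G : Type*} [Group G] [TopologicalSpace G] [IsTopologicalGroup G]
  [CompactSpace G] [SecondCountableTopology G] [MeasurableSpace G] [BorelSpace G]

/-- **THE HEAT-BATH FLOOR WITH THE EXACT CONSTANT `A(cold) = Z/(c^{#B} M^k)`** (ranked structure only; no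
closing map).  (a) acceptance mass from `U` `≤ Z/(c^{#B} F_R(U))`; (b) every event `A ⊆ {F_R > θ M^k}` of
positive target probability has `τ_int(1_A − π(A)) ≥ 1/(π(A) + (Z/(c^{#B}M^k))/θ) − 1/2`. [ours] -/
theorem heatBath_exactFloor (hL : 2 ≤ L) {w : G → ℝ} (hw : Continuous w) {m M : ℝ} (hm0 : 0 < m)
    (hm : ∀ g, m ≤ w g) (hM : ∀ g, w g ≤ M)
    (B : Finset (Plaquette d L)) (t : Plaquette d L → Edge d L)
    (ht : ∀ p ∈ B, t p ∈ ({(p.1, p.2.1.1), (p.1.shift p.2.1.1, p.2.1.2),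
        (p.1.shift p.2.1.2, p.2.1.1), (p.1, p.2.1.2)} : Finset (Edge d L)))
    (rank : Plaquette d L → ℕ)
    (hrank : ∀ p ∈ B, ∀ p' ∈ B, p ≠ p' → t p ∈ ({(p'.1, p'.2.1.1), (p'.1.shift p'.2.1.1, p'.2.1.2),
        (p'.1.shift p'.2.1.2, p'.2.1.1), (p'.1, p'.2.1.2)} : Finset (Edge d L)) → rank p < rank p')
    (π q : Measure (GaugeConfig d L G)) [IsProbabilityMeasure π] [IsProbabilityMeasure q]
    (hπ : π = (Measure.pi fun _ : Edge d L => haarProbability G).withDensity fun U =>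
      ENNReal.ofReal ((∏ p : Plaquette d L, w (plaquetteHolonomy U p.1 p.2.1.1 p.2.1.2)) /
        ∫ V, ∏ p : Plaquette d L, w (plaquetteHolonomy V p.1 p.2.1.1 p.2.1.2)
          ∂(Measure.pi fun _ : Edge d L => haarProbability G)))
    (hq : q = (Measure.pi fun _ : Edge d L => haarProbability G).withDensity fun U =>
      ENNReal.ofReal ((∏ p ∈ B, w (plaquetteHolonomy U p.1 p.2.1.1 p.2.1.2)) /
        ∫ V, ∏ p ∈ B, w (plaquetteHolonomy V p.1 p.2.1.1 p.2.1.2)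
          ∂(Measure.pi fun _ : Edge d L => haarProbability G))) :
    (∀ U : GaugeConfig d L G, (imhAcceptMass q (fun U =>
        ((∫ V, ∏ p : Plaquette d L, w (plaquetteHolonomy V p.1 p.2.1.1 p.2.1.2)
            ∂(Measure.pi fun _ : Edge d L => haarProbability G)) /
          ((∫ V, ∏ p ∈ B, w (plaquetteHolonomy V p.1 p.2.1.1 p.2.1.2)
            ∂(Measure.pi fun _ : Edge d L => haarProbability G)) *
            ∏ p ∈ Finset.univ \ B, w (plaquetteHolonomy U p.1 p.2.1.1 p.2.1.2)))⁻¹) U).toReal ≤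
        (∫ V, ∏ p : Plaquette d L, w (plaquetteHolonomy V p.1 p.2.1.1 p.2.1.2)
            ∂(Measure.pi fun _ : Edge d L => haarProbability G)) /
          ((∫ g, w g ∂(haarProbability G)) ^ B.card *
            ∏ p ∈ Finset.univ \ B, w (plaquetteHolonomy U p.1 p.2.1.1 p.2.1.2))) ∧
    ∀ θ : ℝ, 0 < θ → ∀ A : Set (GaugeConfig d L G), MeasurableSet A →
      (∀ U ∈ A, θ * M ^ (Finset.univ \ B).card < ∏ p ∈ Finset.univ \ B, w (plaquetteHolonomy U p.1 p.2.1.1 p.2.1.2)) →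
      0 < π.real A →
      1 / (π.real A + ((∫ V, ∏ p : Plaquette d L, w (plaquetteHolonomy V p.1 p.2.1.1 p.2.1.2)
            ∂(Measure.pi fun _ : Edge d L => haarProbability G)) /
          ((∫ g, w g ∂(haarProbability G)) ^ B.card * M ^ (Finset.univ \ B).card)) / θ) - 1 / 2 ≤
        tauInt (fun n => autocov (indepMH q fun U =>
          ((∫ V, ∏ p : Plaquette d L, w (plaquetteHolonomy V p.1 p.2.1.1 p.2.1.2)
              ∂(Measure.pi fun _ : Edge d L => haarProbability G)) /
            ((∫ V, ∏ p ∈ B, w (plaquetteHolonomy V p.1 p.2.1.1 p.2.1.2)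
              ∂(Measure.pi fun _ : Edge d L => haarProbability G)) *
              ∏ p ∈ Finset.univ \ B, w (plaquetteHolonomy U p.1 p.2.1.1 p.2.1.2)))⁻¹) π
            (fun U => A.indicator (fun _ => (1 : ℝ)) U - π.real A) n /
          autocov (indepMH q fun U =>
          ((∫ V, ∏ p : Plaquette d L, w (plaquetteHolonomy V p.1 p.2.1.1 p.2.1.2)
              ∂(Measure.pi fun _ : Edge d L => haarProbability G)) /
            ((∫ V, ∏ p ∈ B, w (plaquetteHolonomy V p.1 p.2.1.1 p.2.1.2)
              ∂(Measure.pi fun _ : Edge d L => haarProbability G)) *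
              ∏ p ∈ Finset.univ \ B, w (plaquetteHolonomy U p.1 p.2.1.1 p.2.1.2)))⁻¹) π
            (fun U => A.indicator (fun _ => (1 : ℝ)) U - π.real A) 0) := by
  set Haar : Measure (GaugeConfig d L G) := Measure.pi fun _ : Edge d L => haarProbability G with hHaar
  set FT : GaugeConfig d L G → ℝ := fun U => ∏ p : Plaquette d L, w (plaquetteHolonomy U p.1 p.2.1.1 p.2.1.2)
    with hFT
  set FB : GaugeConfig d L G → ℝ := fun U => ∏ p ∈ B, w (plaquetteHolonomy U p.1 p.2.1.1 p.2.1.2) with hFB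
  set FR : GaugeConfig d L G → ℝ := fun U => ∏ p ∈ Finset.univ \ B, w (plaquetteHolonomy U p.1 p.2.1.1 p.2.1.2)
    with hFR
  set ZT : ℝ := ∫ V, FT V ∂Haar with hZT
  set ZB : ℝ := ∫ V, FB V ∂Haar with hZB
  set k : ℕ := (Finset.univ \ B).card with hk
  have hw0 : ∀ g, 0 < w g := fun g => hm0.trans_le (hm g)
  have hMpos : 0 < M := (hw0 1).trans_le (hM 1)
  haveI : IsProbabilityMeasure Haar := by rw [hHaar]; infer_instance
  have hc : 0 < ∫ g, w g ∂(haarProbability G) := haarProbability_integral_pos_of_continuous_pos hw hw0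
  have hFTc : Continuous FT := continuous_prodPlaquetteWeight_anyDim hw Finset.univ
  have hFRc : Continuous FR := continuous_prodPlaquetteWeight_anyDim hw (Finset.univ \ B)
  have hFTpos : ∀ U, 0 < FT U := fun U => prod_pos fun p _ => hw0 _
  have hFBpos : ∀ U, 0 < FB U := fun U => prod_pos fun p _ => hw0 _
  have hFRpos : ∀ U, 0 < FR U := fun U => prod_pos fun p _ => hw0 _
  have hFRle : ∀ U, FR U ≤ M ^ k := fun U => (pow_le_prodPlaquetteWeight_le_pow_anyDim hm0 hm hM _ U).2
  have hsplit : ∀ U, FT U = FR U * FB U := fun U => (Finset.prod_sdiff (Finset.subset_univ B)).symm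
  have hFTi : Integrable FT Haar := by
    refine Integrable.mono' (integrable_const (M ^ (Finset.univ : Finset (Plaquette d L)).card))
      hFTc.aestronglyMeasurable (ae_of_all _ fun U => ?_)
    rw [Real.norm_eq_abs, abs_of_pos (hFTpos U)]
    exact (pow_le_prodPlaquetteWeight_le_pow_anyDim hm0 hm hM _ U).2
  have hZTpos : 0 < ZT := by
    have h := integral_mono (integrable_const (m ^ (Finset.univ : Finset (Plaquette d L)).card)) hFTi
      fun U => (pow_le_prodPlaquetteWeight_le_pow_anyDim hm0 hm hM _ U).1
    rw [integral_const, smul_eq_mul, probReal_univ, one_mul] at h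
    exact lt_of_lt_of_le (pow_pos hm0 _) h
  have hZB' : ZB = (∫ g, w g ∂(haarProbability G)) ^ B.card :=
    integral_prod_weight_eq_pow_of_rank (G := G) hL hw hm0 hm hM B t ht rank hrank
  have hZBpos : 0 < ZB := by rw [hZB']; exact pow_pos hc _
  -- the density ratio `ρ = Z/(Z_B F_R)` and the kernel weight `ρ⁻¹`
  set ρ : GaugeConfig d L G → ℝ := fun U => ZT / (ZB * FR U) with hρ
  have hρpos : ∀ U, 0 < ρ U := fun U => div_pos hZTpos (mul_pos hZBpos (hFRpos U))
  have hρm : Measurable ρ := (continuous_const.div (continuous_const.mul hFRc)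
    fun U => (mul_pos hZBpos (hFRpos U)).ne').measurable
  have hρq : q = π.withDensity fun U => ENNReal.ofReal (ρ U) := by
    rw [hq, hπ]
    change Haar.withDensity (fun U => ENNReal.ofReal (FB U / ZB)) =
      (Haar.withDensity fun U => ENNReal.ofReal (FT U / ZT)).withDensity fun U => ENNReal.ofReal (ρ U)
    rw [← withDensity_mul _ (by fun_prop : Measurable fun U => ENNReal.ofReal (FT U / ZT))
      (by exact hρm.ennreal_ofReal)]
    refine withDensity_congr_ae (ae_of_all _ fun U => ?_)
    simp only [Pi.mul_apply]
    rw [← ENNReal.ofReal_mul (div_nonneg (hFTpos U).le hZTpos.le)]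
    congr 1
    rw [hρ, hsplit U]
    field_simp [(hFRpos U).ne', hZBpos.ne', hZTpos.ne']
  have hπ' : (q.withDensity fun U => ENNReal.ofReal (ρ U)⁻¹) = π := withDensity_inv_density hρm hρpos hρq
  have hwm : Measurable fun U => (ρ U)⁻¹ := hρm.inv
  have hw0' : ∀ U, 0 < (ρ U)⁻¹ := fun U => inv_pos.2 (hρpos U)
  have hwb : ∀ U, |(ρ U)⁻¹| ≤ ZB * M ^ k / ZT := by
    intro U
    rw [abs_of_pos (hw0' U), hρ, inv_div]
    exact div_le_div_of_nonneg_right (mul_le_mul_of_nonneg_left (hFRle U) hZBpos.le) hZTpos.le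
  have hwi : Integrable (fun U => (ρ U)⁻¹) q := integrable_of_bounded q hwm hwb
  -- (a) the acceptance mass from `U` is at most `ρ(U) = Z/(c^{#B} F_R(U))`
  have hone : ∫⁻ y, ENNReal.ofReal (ρ y)⁻¹ ∂q = 1 := by
    have h : π Set.univ = 1 := measure_univ
    rw [← hπ', withDensity_apply _ MeasurableSet.univ, Measure.restrict_univ] at h
    exact h
  have hacc : ∀ U, (imhAcceptMass q (fun U => (ρ U)⁻¹) U).toReal ≤ ρ U := by
    intro U
    have h := imhAcceptMass_le (q := q) hw0' U
    rw [hone, mul_one, inv_inv] at h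
    have h2 := ENNReal.toReal_mono ENNReal.ofReal_ne_top h
    rwa [ENNReal.toReal_ofReal (hρpos U).le] at h2
  refine ⟨fun U => ?_, ?_⟩
  · rw [← hZB']
    exact hacc U
  -- (b) the `τ_int` floor of a frozen event
  intro θ hθ A hA hAθ hApos
  have hAc0 : 0 ≤ ZT / ((∫ g, w g ∂(haarProbability G)) ^ B.card * M ^ k) :=
    div_nonneg hZTpos.le (mul_nonneg (pow_nonneg hc.le _) (pow_nonneg hMpos.le _))
  have hηA : ∀ U ∈ A, (imhAcceptMass q (fun U => (ρ U)⁻¹) U).toReal ≤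
      ZT / ((∫ g, w g ∂(haarProbability G)) ^ B.card * M ^ k) / θ := by
    intro U hU
    have h' : θ * M ^ k < FR U := hAθ U hU
    refine (hacc U).trans ?_
    rw [hρ, hZB']
    calc ZT / ((∫ g, w g ∂(haarProbability G)) ^ B.card * FR U)
        ≤ ZT / ((∫ g, w g ∂(haarProbability G)) ^ B.card * (θ * M ^ k)) :=
          div_le_div_of_nonneg_left hZTpos.le (mul_pos (pow_pos hc _) (mul_pos hθ (pow_pos hMpos _)))
            (mul_le_mul_of_nonneg_left h'.le (pow_nonneg hc.le _))
      _ = ZT / ((∫ g, w g ∂(haarProbability G)) ^ B.card * M ^ k) / θ := by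
          rw [div_div]; congr 1; ring
  set g : GaugeConfig d L G → ℝ := fun U => A.indicator (fun _ => (1 : ℝ)) U - π.real A with hg
  have hp1 : π.real A ≤ 1 := measureReal_le_one
  have hgm : Measurable g := (measurable_const.indicator hA).sub measurable_const
  have hgb : ∀ U, |g U| ≤ 1 := by
    intro U
    by_cases hU : U ∈ A
    · simp only [hg, Set.indicator_of_mem hU]
      rw [abs_le]; constructor <;> linarith [hApos.le, hp1]
    · simp only [hg, Set.indicator_of_notMem hU]
      rw [abs_le]; constructor <;> linarith [hApos.le, hp1]
  have hg0 : ∫ U, g U ∂π = 0 := by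
    simp only [hg]
    rw [integral_sub ((integrable_const _).indicator hA) (integrable_const _),
      integral_indicator_const (1 : ℝ) hA, integral_const, smul_eq_mul, smul_eq_mul, mul_one,
      probReal_univ, one_mul, sub_self]
  have hcov := (plaquetteBlockProposal_autocorrelation (G := G) hw hm0 hm hM B π q hπ hq hgm hgb hg0).1
  -- summability of the autocorrelation series (Doeblin envelope of the scorecard)
  have hsum : Summable fun n => autocov (indepMH q fun U => (ρ U)⁻¹) π g (n + 1) /
      autocov (indepMH q fun U => (ρ U)⁻¹) π g 0 := by
    by_cases hz : autocov (indepMH q fun U => (ρ U)⁻¹) π g 0 = 0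
    · simp only [hz, div_zero]; exact summable_zero
    · have hC0 : 0 < autocov (indepMH q fun U => (ρ U)⁻¹) π g 0 := by
        rw [autocov_zero] at hz ⊢
        exact lt_of_le_of_ne (integral_nonneg fun U => sq_nonneg _) (Ne.symm hz)
      have hr0 : 0 ≤ 1 - (m / M) ^ k := by
        have : (m / M) ^ k ≤ 1 := pow_le_one₀ (div_nonneg hm0.le hMpos.le)
          ((div_le_one hMpos).2 (by linarith [hm 1, hM 1]))
        linarith
      have hr1 : 1 - (m / M) ^ k < 1 := by
        have : 0 < (m / M) ^ k := pow_pos (div_pos hm0 hMpos) _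
        linarith
      refine Summable.of_norm_bounded ((summable_geometric_of_lt_one hr0 hr1).mul_left (1 - (m / M) ^ k))
        fun n => ?_
      rw [Real.norm_eq_abs, abs_div, abs_of_pos hC0, div_le_iff₀ hC0]
      have h := hcov (n + 1)
      rw [← autocov_zero] at h
      calc |autocov (indepMH q fun U => (ρ U)⁻¹) π g (n + 1)|
          ≤ (1 - (m / M) ^ k) ^ (n + 1) * autocov (indepMH q fun U => (ρ U)⁻¹) π g 0 := h
        _ = (1 - (m / M) ^ k) * (1 - (m / M) ^ k) ^ n *
              autocov (indepMH q fun U => (ρ U)⁻¹) π g 0 := by ring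
  exact indepMH_event_tauInt_ge hwm hw0' hwi hπ' hA (div_nonneg hAc0 hθ.le) hηA hApos hsum

end Summit.Ventures.LatticeQCDFlow.Theory2.Autoregressive

end
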